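import Mathlib.Topology.Algebra.ClopenNhdofOne
import Mathlib.CategoryTheory.Galois.Prorepresentability
import Mathlib.GroupTheory.DoubleCoset
import Literature.AnabelianGeometry.SemiGraphs.CommensurabilityProofs4

/-!
# Lemmas for [SemiAnbd] Corollary 2.7 (i) (commensurable terminality): profinite and Galois bookkeeping

Companion (theorems only) of `Literature/AnabelianGeometry/SemiGraphs/Commensurability.lean`,
serving the reduction of the named fact `corollary_2_7_i` ([SemiAnbd] Cor. 2.7 (i), p. 30) to
Proposition 2.6 and the finite étale covering dictionary (abc-iut DISCHARGE-L3 §G rows G27/G30):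

* `exists_openNormalSubgroup_forall_mul_ne` — in a profinite group, an element outside a closed
  subgroup `K` lies outside `K·N` for some open normal subgroup `N` (the step "there exists a
  connected finite Galois étale covering `𝒢′ → 𝒢` … such that `g · ℋ″ ≠ ℋ″`" of the printed proof);
* `isClosed_range_piHToPi` — the image of `Π_ℍ → Π_𝒢` is closed (Remark 2.2.1 pattern);
* `stabilizer_eq_of_isGalois` — for a Galois object all points of the fibre have the same
  stabiliser in `π₁` ([SGA1] V: the decomposition group of a Galois covering is normal);
* `ConjAct` / double-coset bookkeeping (`map_conjAct_smul`, `relIndex_conj_inter_ne_zero`, …),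
  with a private copy of `mem_conjAct_smul_iff` (`CoverticialCoveringGroupLemmas.lean`).
-/

namespace Literature.AnabelianGeometry.SemiGraphs

open CategoryTheory CategoryTheory.PreGaloisCategory
open scoped Pointwise

universe w v₁ u₁ u

/-- In a profinite group `P`, if `g ∉ K` for a closed subgroup `K`, then `g ∉ K·N` for some open
normal subgroup `N` (the compact set `K⁻¹g` misses `1`, so its complement contains an open normal
subgroup). [cite: MochizukiSemiAnbd2006, Cor. 2.7(i) p.30] -/
theorem exists_openNormalSubgroup_forall_mul_ne {P : Type*} [Group P] [TopologicalSpace P]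
    [IsTopologicalGroup P] [CompactSpace P] [T2Space P] [TotallyDisconnectedSpace P]
    (K : Subgroup P) (hK : IsClosed (K : Set P)) {g : P} (hg : g ∉ K) :
    ∃ N : OpenNormalSubgroup P, ∀ k ∈ K, ∀ n ∈ N, k * n ≠ g := by
  have hSc : IsCompact ((fun k : P => k⁻¹ * g) '' (K : Set P)) :=
    hK.isCompact.image (by fun_prop)
  have h1 : (1 : P) ∈ ((fun k : P => k⁻¹ * g) '' (K : Set P))ᶜ := by
    rintro ⟨k, hk, h⟩
    apply hg
    have hgk : g = k := by
      have h' : k⁻¹ * g = 1 := h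
      rw [inv_mul_eq_one] at h'
      exact h'.symm
    rw [hgk]
    exact hk
  obtain ⟨N, hN⟩ :=
    ProfiniteGrp.exist_openNormalSubgroup_sub_open_nhds_of_one hSc.isClosed.isOpen_compl h1
  refine ⟨N, fun k hk n hn h => ?_⟩
  have hmem : n ∈ (fun k : P => k⁻¹ * g) '' (K : Set P) :=
    ⟨k, hk, by simp only; rw [← h, inv_mul_cancel_left]⟩
  exact hN hn hmem

namespace SemiGraphOfAnabelioids

/-- The image of `Π_ℍ → Π_𝒢` is closed (continuous image of a compact group in a Hausdorff group).
[cite: MochizukiSemiAnbd2006, Rem. 2.2.1 p.24] -/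
theorem isClosed_range_piHToPi (𝒢 : SemiGraphOfAnabelioids.{v₁, u₁, u}) (H : 𝒢.graph.Subgraph)
    (w : H.toSemiGraph.Vertex) (F : 𝒢.V w.1 ⥤ FintypeCat.{v₁}) :
    IsClosed ((𝒢.piHToPi H w F).range : Set (𝒢.Pi w.1 F)) := by
  rw [MonoidHom.coe_range]
  exact (isCompact_range (continuous_pi1Map _ _)).isClosed

end SemiGraphOfAnabelioids

/-- For a Galois object `A` of a Galois category with fibre functor `F`, all points of `F(A)` have
the same stabiliser in `Aut F` (it is the kernel of the action): `Aut A` acts transitively on the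
fibre and commutes with `Aut F`. [cite: SGA1, Exp. V Cor. 5.7] -/
theorem stabilizer_eq_of_isGalois {C : Type*} [Category* C] [GaloisCategory C]
    (F : C ⥤ FintypeCat.{w}) [FiberFunctor F] (A : C) [IsGalois A] (a b : F.obj A) :
    MulAction.stabilizer (Aut F) a = MulAction.stabilizer (Aut F) b := by
  suffices h : ∀ a b : F.obj A, MulAction.stabilizer (Aut F) a ≤ MulAction.stabilizer (Aut F) b from
    le_antisymm (h a b) (h b a)
  intro a b σ hσ
  haveI : MulAction.IsPretransitive (Aut A) (F.obj A) :=
    (isGalois_iff_pretransitive F A).1 inferInstance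
  obtain ⟨f, rfl⟩ := MulAction.exists_smul_eq (Aut A) a b
  rw [MulAction.mem_stabilizer_iff] at hσ ⊢
  have hnat := FunctorToFintypeCat.naturality F F σ.hom f.hom a
  -- hnat : σ.hom.app A (F.map f.hom a) = F.map f.hom (σ.hom.app A a)
  change σ.hom.app A (F.map f.hom a) = F.map f.hom a
  rw [hnat]
  change F.map f.hom (σ • a) = F.map f.hom a
  rw [hσ]


/-! ### Conjugation bookkeeping for subgroups (`ConjAct`) -/

/-- Membership in a conjugate subgroup — a private copy of the tree's
`CoverticialCoveringGroupLemmas.mem_conjAct_smul_iff` (not imported here to keep this file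
independent of that module's build). [folklore] -/
private theorem mem_conjAct_smul_iff' {G : Type*} [Group G] (g x : G) (H : Subgroup G) :
    x ∈ ConjAct.toConjAct g • H ↔ g⁻¹ * x * g ∈ H := by
  rw [Subgroup.mem_pointwise_smul_iff_inv_smul_mem, ← map_inv, ConjAct.smul_def,
    ConjAct.ofConjAct_toConjAct, inv_inv]

/-- Conjugating a subgroup by one of its elements does nothing. [cite: MochizukiSemiAnbd2006, Cor. 2.7(i) p.30] -/
theorem conjAct_smul_eq_self_of_mem {G : Type*} [Group G] {H : Subgroup G} {g : G} (hg : g ∈ H) :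
    ConjAct.toConjAct g • H = H := by
  ext x
  rw [mem_conjAct_smul_iff']
  constructor
  · intro h
    have := H.mul_mem (H.mul_mem hg h) (H.inv_mem hg)
    simpa [mul_assoc] using this
  · intro h
    exact H.mul_mem (H.mul_mem (H.inv_mem hg) h) hg

/-- The image of a conjugate subgroup is the conjugate of the image. [cite: MochizukiSemiAnbd2006, Cor. 2.7(i) p.30] -/
theorem map_conjAct_smul {G G' : Type*} [Group G] [Group G'] (f : G →* G') (g : G)
    (H : Subgroup G) :
    (ConjAct.toConjAct g • H).map f = ConjAct.toConjAct (f g) • H.map f := by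
  ext y
  constructor
  · rintro ⟨x, hx, rfl⟩
    rw [SetLike.mem_coe, mem_conjAct_smul_iff'] at hx
    rw [mem_conjAct_smul_iff', Subgroup.mem_map]
    exact ⟨g⁻¹ * x * g, hx, by simp only [map_mul, map_inv]⟩
  · intro hy
    rw [mem_conjAct_smul_iff', Subgroup.mem_map] at hy
    obtain ⟨x, hx, hxy⟩ := hy
    refine ⟨g * x * g⁻¹, ?_, ?_⟩
    · rw [SetLike.mem_coe, mem_conjAct_smul_iff']
      simpa [mul_assoc] using hx
    · simp only [map_mul, map_inv, hxy]
      group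

/-- A subgroup lies in its own commensurator. [cite: MochizukiSemiAnbd2006, Cor. 2.7(i) p.30] -/
theorem le_commensurator_self {G : Type*} [Group G] (H : Subgroup G) :
    H ≤ Subgroup.Commensurable.commensurator H := fun g hg => by
  rw [Subgroup.Commensurable.commensurator_mem_iff, conjAct_smul_eq_self_of_mem hg]

/-- The group-theoretic end of the proof of [SemiAnbd] Cor. 2.7 (i): if `g⁻¹` commensurates
`P_H` and `g = p₁ g₁ q₁` (`p₁ ∈ P_H`, `q₁ ∈ P′`), then `q₁⁻¹ (P′ ∩ g₁⁻¹ P_H g₁) q₁ = P′ ∩ g⁻¹ P_H g`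
has non-zero (i.e. finite) index relative to `P′ ∩ P_H`. [cite: MochizukiSemiAnbd2006, Cor. 2.7(i) p.30] -/
theorem relIndex_conj_inter_ne_zero {G : Type*} [Group G] (PH P' : Subgroup G) {g g₁ p₁ q₁ : G}
    (hp₁ : p₁ ∈ PH) (hq₁ : q₁ ∈ P') (hg : g = p₁ * g₁ * q₁)
    (hcomm : (ConjAct.toConjAct g⁻¹ • PH).relIndex PH ≠ 0) :
    (ConjAct.toConjAct q₁⁻¹ • (P' ⊓ ConjAct.toConjAct g₁⁻¹ • PH)).relIndex (P' ⊓ PH) ≠ 0 := by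
  have h1 : q₁⁻¹ * g₁⁻¹ = g⁻¹ * p₁ := by
    rw [hg]
    group
  have key : ConjAct.toConjAct q₁⁻¹ • (P' ⊓ ConjAct.toConjAct g₁⁻¹ • PH) =
      P' ⊓ ConjAct.toConjAct g⁻¹ • PH := by
    rw [Subgroup.smul_inf, conjAct_smul_eq_self_of_mem (P'.inv_mem hq₁), ← mul_smul, ← map_mul,
      h1, map_mul, mul_smul, conjAct_smul_eq_self_of_mem hp₁]
  rw [key, inf_comm P' (ConjAct.toConjAct g⁻¹ • PH), inf_comm P' PH]
  exact Subgroup.relIndex_inter_ne_zero hcomm P'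

end Literature.AnabelianGeometry.SemiGraphs
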